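import Mathlib
import HarnessLib
import Literature.MathematicalPhysics.QuantumLattice.TorusCooperSum
import Summits.HubbardSuperconductivity.HubbardSuperconductivity.Theorems.KLProgrammeMatsubaraTadpoleBounds
import Summits.HubbardSuperconductivity.HubbardSuperconductivity.Theorems.KLProgrammeC4aPPKernelNegPreThermal

/-!
# Route `KLProgramme` — ENGINE item stmt-HubbardSuperconductivity-20437, row (C) credit path, GAP G-005 «TADPOLE-NONVANISHING»:
# THE UV HARTREE SUM IS BOUNDED BELOW BY THE VAN HOVE SHELL — ANTIPODAL PAIRING, GENERIC WEIGHT (cell gate-hubbard-kl, registrant seat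
# gate-hubbard-kl-p1b g18; D-0071 pre-staging of route v3 step (iii), KL STATUS 2026-08-29 p1b g18)

WHAT.  The opposite-spin UV Hartree constant of the scale-`0` action is (up to `(βL²)⁻¹` and sign) `Σ_k T_k`,
`T_k := β⁻¹ Σᵢ w(i,k)·e_k/(ωᵢ² + e_k²)`, `e_k = ε_L(k) − μ`, with a cutoff weight `0 ≤ w ≤ 1` that equals `1` off the sliver `|e_k| < Λ₀`.  This file proves, for ANY such
weight and ANY bijection `σ` of the zone with `|ε_L(σk) + ε_L(k)| ≤ δ` (the half-zone shift: `δ = 0` for even `L`, `δ = 4π/L` in general):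
**`sum_uvTadpole_ge`**: `½·(N·(1 − 2e^{−βΛ₀}) − L²·(2τ + e^{−βE₁})) ≤ Σ_k T_k`, where `N = #{k : |ε_L(k)| ≤ −μ − Λ₀ − δ}` (the van Hove shell, counted from
below by `card_vanHoveShell_ge`, p717073), `τ = (4 − μ)·β/(π²M)` (Matsubara truncation tail, p716777) and `E₁ = −2μ − Λ₀ − 2δ` (`μ < 0`, `Λ₀ + δ ≤ −μ`).
IDEA (route v3): `Σ_k T_k = ½Σ_k (T_k + T_{σk})`; a momentum with `|ε| ≤ −μ−Λ₀−δ` and its partner are both at level `≥ Λ₀` (each `T ≥ ½ − e^{−βΛ₀} − τ`); otherwise ONE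
of the two is at level `≥ E₁` (`T ≥ ½ − e^{−βE₁} − τ`) while the other is `≥ −½` for ANY weight — so the sliver `|e| < Λ₀`, where the weight is unknown, never needs to
be counted: it cancels against its particle–hole partner.
* `uvTadpoleTerm_ge_neg_half` — `T_k ≥ −½` for every `k` (weight in `[0,1]`; `abs_inv_mul_sum_matsubaraIdx_div_le_half`);
* `uvTadpoleTerm_ge_of_le` — off the sliver, at level `e_k ≥ E > 0`: `T_k ≥ ½ − e^{−βE} − (4−μ)β/(π²M)` (`half_tanh_sub_le_mul_sum_matsubaraIdx` + the landed `C4a.one_sub_tanh_le_two_exp_neg`);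
* `uvTadpolePair_ge` — the per-pair bound; `sum_uvTadpole_ge` — the assembly.
Elementary; nothing here asserts G-005 (the reduction of `evalM (klFlowPiece … 0) q` to this sum is the scale-0 lane's), any row of 20437, K3, the Kohn–Luttinger margin or
superconductivity.  0 kit · 0 lit.  References: BGM 2006 §2.1–2.3 (tadpole / chemical-potential counterterm) [cite: BenfattoGiulianiMastropietro2006]; Lieb 1989 (particle–hole
symmetry of the bipartite band) [folklore].
-/

noncomputable section

namespace Summit.HubbardSuperconductivity.HubbardSuperconductivity.Theorems.MatsubaraTadpole

set_option linter.dupNamespace false -- summit = problem name (single-conjunct summit), D-0017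

open Real Finset Literature.MathematicalPhysics.QuantumLattice Literature.Probability.LatticeModels

section Terms

variable {L M : ℕ} [NeZero L] {β μ : ℝ}

omit [NeZero L] in
/-- **The tadpole term is at least `−½` for every momentum and every weight in `[0,1]`** (`T_k = β⁻¹ Σᵢ w(i,k)·e_k/(ωᵢ² + e_k²)`, `e_k = ε_L(k) − μ`). -/
theorem uvTadpoleTerm_ge_neg_half (hβ : 0 < β) (w : MatsubaraIdx M → TorusSite 2 L → ℝ)
    (hw0 : ∀ i k, 0 ≤ w i k) (hw1 : ∀ i k, w i k ≤ 1) (k : TorusSite 2 L) :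
    -(1 / 2 : ℝ) ≤ β⁻¹ * ∑ i : MatsubaraIdx M, w i k * ((torusBand L k - μ) / (matsubaraFreq β M i ^ 2 + (torusBand L k - μ) ^ 2)) := by
  set e : ℝ := torusBand L k - μ with he
  rcases le_or_gt 0 e with he0 | he0
  · -- every summand is nonnegative
    have : 0 ≤ ∑ i : MatsubaraIdx M, w i k * (e / (matsubaraFreq β M i ^ 2 + e ^ 2)) :=
      Finset.sum_nonneg fun i _ => mul_nonneg (hw0 i k) (div_nonneg he0 (by positivity))
    have : 0 ≤ β⁻¹ * ∑ i : MatsubaraIdx M, w i k * (e / (matsubaraFreq β M i ^ 2 + e ^ 2)) := mul_nonneg (inv_nonneg.2 hβ.le) this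
    linarith
  · -- every summand is `≥` the unweighted (nonpositive) one
    have hmono : ∑ i : MatsubaraIdx M, e / (matsubaraFreq β M i ^ 2 + e ^ 2) ≤
        ∑ i : MatsubaraIdx M, w i k * (e / (matsubaraFreq β M i ^ 2 + e ^ 2)) := by
      refine Finset.sum_le_sum fun i _ => ?_
      have hx : e / (matsubaraFreq β M i ^ 2 + e ^ 2) ≤ 0 := div_nonpos_of_nonpos_of_nonneg he0.le (by positivity)
      nlinarith [hw0 i k, hw1 i k]
    have habs := abs_inv_mul_sum_matsubaraIdx_div_le_half hβ e M
    have hlow : -(1 / 2 : ℝ) ≤ β⁻¹ * ∑ i : MatsubaraIdx M, e / (matsubaraFreq β M i ^ 2 + e ^ 2) := (abs_le.1 habs).1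
    exact hlow.trans (mul_le_mul_of_nonneg_left hmono (inv_nonneg.2 hβ.le))

omit [NeZero L] in
/-- **Off the sliver, above a level `E > 0`, the tadpole term is at least `½ − e^{−βE} − (4−μ)β/(π²M)`** (weight `≡ 1` there). -/
theorem uvTadpoleTerm_ge_of_le (hβ : 0 < β) (hM : 1 ≤ M) {Λ₀ : ℝ} (w : MatsubaraIdx M → TorusSite 2 L → ℝ)
    (hwΛ : ∀ i k, Λ₀ ≤ |torusBand L k - μ| → w i k = 1) (k : TorusSite 2 L) {E : ℝ} (hE : 0 < E)
    (hEk : E ≤ torusBand L k - μ) (hΛk : Λ₀ ≤ torusBand L k - μ) :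
    1 / 2 - Real.exp (-(β * E)) - (4 - μ) * β / (π ^ 2 * M) ≤
      β⁻¹ * ∑ i : MatsubaraIdx M, w i k * ((torusBand L k - μ) / (matsubaraFreq β M i ^ 2 + (torusBand L k - μ) ^ 2)) := by
  set e : ℝ := torusBand L k - μ with he
  have he0 : 0 < e := hE.trans_le hEk
  have hwk : ∀ i, w i k = 1 := fun i => hwΛ i k (by rw [abs_of_pos he0]; exact hΛk)
  have hsum : ∑ i : MatsubaraIdx M, w i k * (e / (matsubaraFreq β M i ^ 2 + e ^ 2)) =
      e * ∑ i : MatsubaraIdx M, 1 / (matsubaraFreq β M i ^ 2 + e ^ 2) := by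
    rw [Finset.mul_sum]
    refine Finset.sum_congr rfl fun i _ => ?_
    rw [hwk i, one_mul, mul_one_div]
  rw [hsum]
  have hmain := half_tanh_sub_le_mul_sum_matsubaraIdx hβ he0 hM
  -- `tanh` from below and the tail from above
  have htanh : 1 - 2 * Real.exp (-(β * E)) ≤ Real.tanh (β * e / 2) := by
    have h1 := Summit.HubbardSuperconductivity.HubbardSuperconductivity.Theorems.C4a.one_sub_tanh_le_two_exp_neg (β * e / 2)
    have h2 : Real.exp (-(2 * (β * e / 2))) ≤ Real.exp (-(β * E)) := by
      apply Real.exp_le_exp.2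
      have : β * E ≤ β * e := mul_le_mul_of_nonneg_left hEk hβ.le
      linarith
    linarith
  have he4 : e ≤ 4 - μ := by have := torusBand_le_four L k; rw [he]; linarith
  have hM0 : (0 : ℝ) < M := by exact_mod_cast hM
  have htail : e * β ^ 2 / (π ^ 2 * M) ≤ (4 - μ) * β ^ 2 / (π ^ 2 * M) := by
    apply div_le_div_of_nonneg_right _ (by positivity)
    exact mul_le_mul_of_nonneg_right he4 (by positivity)
  -- divide the `β`-scaled bound by `β`
  have hkey : β * (1 / 2 - Real.exp (-(β * E)) - (4 - μ) * β / (π ^ 2 * M)) ≤ e * ∑ i : MatsubaraIdx M, 1 / (matsubaraFreq β M i ^ 2 + e ^ 2) := by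
    have : β * (1 / 2 - Real.exp (-(β * E)) - (4 - μ) * β / (π ^ 2 * M)) =
        β / 2 * (1 - 2 * Real.exp (-(β * E))) - (4 - μ) * β ^ 2 / (π ^ 2 * M) := by
      field_simp
    rw [this]
    have hβ2 : 0 ≤ β / 2 := by positivity
    nlinarith [mul_le_mul_of_nonneg_left htanh hβ2]
  refine le_of_mul_le_mul_left ?_ hβ
  rw [← mul_assoc, mul_inv_cancel₀ hβ.ne', one_mul]
  exact hkey

end Terms

/-! ## The pairing -/

section Pairing

variable {L M : ℕ} [NeZero L] {β μ Λ₀ δ : ℝ}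

omit [NeZero L] in
/-- **The per-pair bound.**  With `t = −μ − Λ₀ − δ`, `E₁ = −2μ − Λ₀ − 2δ`, `τ = (4−μ)β/(π²M)`:
`T_k + T_{σk} ≥ 1 − 2e^{−βΛ₀} − 2τ` if `|ε_L(k)| ≤ t`, and `≥ −e^{−βE₁} − τ` otherwise. -/
theorem uvTadpolePair_ge (hβ : 0 < β) (hM : 1 ≤ M) (hΛ : 0 < Λ₀) (hδ : 0 ≤ δ) (hμ : Λ₀ + δ ≤ -μ)
    (w : MatsubaraIdx M → TorusSite 2 L → ℝ) (hw0 : ∀ i k, 0 ≤ w i k) (hw1 : ∀ i k, w i k ≤ 1)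
    (hwΛ : ∀ i k, Λ₀ ≤ |torusBand L k - μ| → w i k = 1)
    (σ : TorusSite 2 L ≃ TorusSite 2 L) (hσ : ∀ k, |torusBand L (σ k) + torusBand L k| ≤ δ) (k : TorusSite 2 L) :
    (if |torusBand L k| ≤ -μ - Λ₀ - δ then 1 - 2 * Real.exp (-(β * Λ₀)) - 2 * ((4 - μ) * β / (π ^ 2 * M))
      else -Real.exp (-(β * (-2 * μ - Λ₀ - 2 * δ))) - (4 - μ) * β / (π ^ 2 * M)) ≤
      β⁻¹ * ∑ i : MatsubaraIdx M, w i k * ((torusBand L k - μ) / (matsubaraFreq β M i ^ 2 + (torusBand L k - μ) ^ 2)) +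
      β⁻¹ * ∑ i : MatsubaraIdx M, w i (σ k) * ((torusBand L (σ k) - μ) / (matsubaraFreq β M i ^ 2 + (torusBand L (σ k) - μ) ^ 2)) := by
  have hσk := abs_le.1 (hσ k)
  have hE₁ : 0 < -2 * μ - Λ₀ - 2 * δ := by linarith
  split_ifs with ht
  · -- both levels are `≥ Λ₀`
    obtain ⟨ht1, ht2⟩ := abs_le.1 ht
    have hk1 : Λ₀ ≤ torusBand L k - μ := by linarith
    have hk2 : Λ₀ ≤ torusBand L (σ k) - μ := by linarith
    have h1 := uvTadpoleTerm_ge_of_le hβ hM w hwΛ k hΛ hk1 hk1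
    have h2 := uvTadpoleTerm_ge_of_le hβ hM w hwΛ (σ k) hΛ hk2 hk2
    linarith
  · rw [not_le] at ht
    rcases lt_abs.1 ht with hpos | hneg
    · -- `ε_k > t`: `k` is high, the partner is `≥ −½`
      have hk1 : -2 * μ - Λ₀ - 2 * δ ≤ torusBand L k - μ := by linarith
      have hk1' : Λ₀ ≤ torusBand L k - μ := by linarith
      have h1 := uvTadpoleTerm_ge_of_le hβ hM w hwΛ k hE₁ hk1 hk1'
      have h2 := uvTadpoleTerm_ge_neg_half hβ w hw0 hw1 (μ := μ) (σ k)
      linarith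
    · -- `ε_k < −t`: the partner is high, `k` is `≥ −½`
      have hk2 : -2 * μ - Λ₀ - 2 * δ ≤ torusBand L (σ k) - μ := by linarith
      have hk2' : Λ₀ ≤ torusBand L (σ k) - μ := by linarith
      have h1 := uvTadpoleTerm_ge_neg_half hβ w hw0 hw1 (μ := μ) k
      have h2 := uvTadpoleTerm_ge_of_le hβ hM w hwΛ (σ k) hE₁ hk2 hk2'
      linarith

/-- **THE UV HARTREE SUM IS BOUNDED BELOW BY THE VAN HOVE SHELL.**  For `β > 0`, `M ≥ 1`, `0 < Λ₀`, `0 ≤ δ`, `Λ₀ + δ ≤ −μ`, any weight `0 ≤ w ≤ 1` equal to `1`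
off the sliver `|ε_L(k) − μ| < Λ₀`, and any bijection `σ` of the zone with `|ε_L(σk) + ε_L(k)| ≤ δ`:
`½·( #{k : |ε_L(k)| ≤ −μ−Λ₀−δ}·(1 − 2e^{−βΛ₀}) − L²·(2(4−μ)β/(π²M) + e^{−β(−2μ−Λ₀−2δ)}) ) ≤ Σ_k β⁻¹Σᵢ w(i,k)·(ε_L(k)−μ)/(ωᵢ² + (ε_L(k)−μ)²)`. -/
theorem sum_uvTadpole_ge (hβ : 0 < β) (hM : 1 ≤ M) (hΛ : 0 < Λ₀) (hδ : 0 ≤ δ) (hμ : Λ₀ + δ ≤ -μ)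
    (w : MatsubaraIdx M → TorusSite 2 L → ℝ) (hw0 : ∀ i k, 0 ≤ w i k) (hw1 : ∀ i k, w i k ≤ 1)
    (hwΛ : ∀ i k, Λ₀ ≤ |torusBand L k - μ| → w i k = 1)
    (σ : TorusSite 2 L ≃ TorusSite 2 L) (hσ : ∀ k, |torusBand L (σ k) + torusBand L k| ≤ δ) :
    (((univ.filter fun k : TorusSite 2 L => |torusBand L k| ≤ -μ - Λ₀ - δ).card : ℝ) * (1 - 2 * Real.exp (-(β * Λ₀))) -
        (L : ℝ) ^ 2 * (2 * ((4 - μ) * β / (π ^ 2 * M)) + Real.exp (-(β * (-2 * μ - Λ₀ - 2 * δ))))) / 2 ≤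
      ∑ k : TorusSite 2 L, β⁻¹ * ∑ i : MatsubaraIdx M, w i k * ((torusBand L k - μ) / (matsubaraFreq β M i ^ 2 + (torusBand L k - μ) ^ 2)) := by
  classical
  set T : TorusSite 2 L → ℝ := fun k =>
    β⁻¹ * ∑ i : MatsubaraIdx M, w i k * ((torusBand L k - μ) / (matsubaraFreq β M i ^ 2 + (torusBand L k - μ) ^ 2)) with hT
  set a : ℝ := 1 - 2 * Real.exp (-(β * Λ₀)) - 2 * ((4 - μ) * β / (π ^ 2 * M)) with ha
  set b : ℝ := -Real.exp (-(β * (-2 * μ - Λ₀ - 2 * δ))) - (4 - μ) * β / (π ^ 2 * M) with hb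
  set g : TorusSite 2 L → ℝ := fun k => if |torusBand L k| ≤ -μ - Λ₀ - δ then a else b with hg
  -- pairing: `2 Σ T = Σ (T + T ∘ σ) ≥ Σ g`
  have hpair : ∀ k, g k ≤ T k + T (σ k) := fun k => by
    simpa only [hg, hT, ha, hb] using uvTadpolePair_ge hβ hM hΛ hδ hμ w hw0 hw1 hwΛ σ hσ k
  have hdouble : ∑ k, (T k + T (σ k)) = 2 * ∑ k, T k := by
    rw [Finset.sum_add_distrib, Equiv.sum_comp σ T, two_mul]
  have hsumg : ∑ k, g k ≤ 2 * ∑ k, T k := by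
    rw [← hdouble]; exact Finset.sum_le_sum fun k _ => hpair k
  -- evaluate `Σ g`
  set N := (univ.filter fun k : TorusSite 2 L => |torusBand L k| ≤ -μ - Λ₀ - δ).card with hN
  have hcardL : (Finset.univ : Finset (TorusSite 2 L)).card = L ^ 2 := by
    rw [Finset.card_univ, card_torusSite_two]
  have hg_eval : ∑ k, g k = (N : ℝ) * a + ((L : ℝ) ^ 2 - N) * b := by
    rw [hg, Finset.sum_ite, Finset.sum_const, Finset.sum_const, nsmul_eq_mul, nsmul_eq_mul]
    have hneg : ((univ.filter fun k : TorusSite 2 L => ¬ |torusBand L k| ≤ -μ - Λ₀ - δ).card : ℝ) = (L : ℝ) ^ 2 - N := by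
      have h := Finset.card_filter_add_card_filter_not (s := (univ : Finset (TorusSite 2 L)))
        (fun k : TorusSite 2 L => |torusBand L k| ≤ -μ - Λ₀ - δ)
      rw [hcardL] at h
      have h' : ((univ.filter fun k : TorusSite 2 L => |torusBand L k| ≤ -μ - Λ₀ - δ).card : ℝ) +
          ((univ.filter fun k : TorusSite 2 L => ¬ |torusBand L k| ≤ -μ - Λ₀ - δ).card : ℝ) = (L : ℝ) ^ 2 := by
        exact_mod_cast h
      rw [hN]; linarith
    rw [hneg, hN]
  -- the crude lower estimate of `Σ g`
  have hNle : (N : ℝ) ≤ (L : ℝ) ^ 2 := by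
    have := Finset.card_filter_le (univ : Finset (TorusSite 2 L)) (fun k : TorusSite 2 L => |torusBand L k| ≤ -μ - Λ₀ - δ)
    rw [hcardL] at this
    exact_mod_cast this
  have hN0 : (0 : ℝ) ≤ N := Nat.cast_nonneg _
  have hτ : 0 ≤ (4 - μ) * β / (π ^ 2 * M) := by
    have hM0 : (0 : ℝ) < M := by exact_mod_cast hM
    have : 0 ≤ 4 - μ := by linarith
    positivity
  have hy : 0 ≤ Real.exp (-(β * (-2 * μ - Λ₀ - 2 * δ))) := (Real.exp_pos _).le
  have hlow : (N : ℝ) * (1 - 2 * Real.exp (-(β * Λ₀))) -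
      (L : ℝ) ^ 2 * (2 * ((4 - μ) * β / (π ^ 2 * M)) + Real.exp (-(β * (-2 * μ - Λ₀ - 2 * δ)))) ≤ (N : ℝ) * a + ((L : ℝ) ^ 2 - N) * b := by
    rw [ha, hb]
    nlinarith [mul_nonneg hN0 hτ, mul_nonneg (sub_nonneg.2 hNle) hτ, mul_nonneg hN0 hy, mul_nonneg (sub_nonneg.2 hNle) hy]
  have : (N : ℝ) * a + ((L : ℝ) ^ 2 - N) * b ≤ 2 * ∑ k, T k := hg_eval ▸ hsumg
  linarith

end Pairing

end Summit.HubbardSuperconductivity.HubbardSuperconductivity.Theorems.MatsubaraTadpole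

end
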